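import Literature.LinearAlgebra.Matrix.DetTraceAMGM
import Mathlib.LinearAlgebra.Matrix.NonsingularInverse
import Mathlib.LinearAlgebra.Matrix.ToLinearEquiv
import HarnessLib

/-!
# Minkowski's determinant inequality and the concavity of `det^{1/N}` on `A ⪰ 0`

For real symmetric positive semidefinite `N × N` matrices (`N ≥ 1`),

`(det A)^{1/N} + (det B)^{1/N} ≤ (det (A + B))^{1/N}` (Minkowski),

equivalently `A ↦ (det A)^{1/N}` is concave on the positive semidefinite cone. This is the
matrix-analysis fact behind the smoothing step of D. Serre's Compensated Integrability
(Serre 2024, Lemma 7: "`det^{1/n}` is a concave function over `Sym⁺_n` (see [9, Theorem 6.10])",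
whence `det(ρ_ε ⋆ A)^{1/n} ≥ ρ_ε ⋆ (det A)^{1/n}` by Jensen). The proof is the variational one
from the determinant–trace AM–GM inequality
(`Literature.LinearAlgebra.Matrix.card_mul_det_mul_det_rpow_le_trace_mul`, Serre's (24)):
`N (det A det C)^{1/N} ≤ Tr(A C)` for every `C ⪰ 0`, with equality at
`C = (det S)^{1/N} S⁻¹` for `S = A + B` invertible (`det C = 1`, `Tr(S C) = N (det S)^{1/N}`);
a singular `A + B` forces `det A = det B = 0`.

* `det_eq_zero_of_posSemidef_add_det_eq_zero` — `det (A + B) = 0 ⇒ det A = 0` (`A, B ⪰ 0`);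
* **`det_rpow_add_det_rpow_le`** — Minkowski's inequality;
* `det_le_det_add_of_posSemidef` — monotonicity `det A ≤ det (A + B)`;
* `det_smul_rpow` — homogeneity `(det (t A))^{1/N} = t (det A)^{1/N}` (`t ≥ 0`);
* **`concaveOn_det_rpow`** — `ConcaveOn ℝ {A | A.PosSemidef} (fun A => (det A)^{1/N})`
  (`convex_setOf_posSemidef`).

Real matrices only. Mathlib has `Matrix.PosSemidef`, `det_smul`, `det_nonsing_inv`,
`exists_mulVec_eq_zero_iff`, but neither Minkowski's inequality nor the concavity of `det^{1/N}`
(`lean search 'det_add|minkowski.*det|ConcaveOn.*det'`).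

## References

* D. Serre, *Compensated integrability on tori; a priori estimate for space-periodic gas flows*,
  C. R. Math. Acad. Sci. Paris 362 (2024) 1425–1444, Lemma 7 and Appendix A (24). [Serre2024]
* D. Serre, *Matrices: Theory and Applications*, 2nd ed., Springer GTM 216 (2010), Thm. 6.10
  (ref. [9] of the paper). [folklore]
-/

open Matrix Finset
open scoped MatrixOrder

namespace Literature.LinearAlgebra.Matrix

variable {n : Type*} [Fintype n] [DecidableEq n]

/-- If `A, B ⪰ 0` and `A + B` is singular then `A` is singular: a kernel vector `x` of `A + B`
has `xᵀ A x + xᵀ B x = 0` with both terms nonnegative, so `A x = 0`. [folklore] -/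
theorem det_eq_zero_of_posSemidef_add_det_eq_zero {A B : Matrix n n ℝ} (hA : A.PosSemidef)
    (hB : B.PosSemidef) (h : (A + B).det = 0) : A.det = 0 := by
  obtain ⟨x, hx0, hx⟩ := Matrix.exists_mulVec_eq_zero_iff.2 h
  have hsum : star x ⬝ᵥ (A *ᵥ x) + star x ⬝ᵥ (B *ᵥ x) = 0 := by
    rw [← dotProduct_add, ← add_mulVec, hx, dotProduct_zero]
  have hAx : star x ⬝ᵥ (A *ᵥ x) = 0 :=
    le_antisymm (by linarith [hA.dotProduct_mulVec_nonneg x, hB.dotProduct_mulVec_nonneg x])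
      (hA.dotProduct_mulVec_nonneg x)
  have hker : A *ᵥ x = 0 := (hA.dotProduct_mulVec_zero_iff x).1 hAx
  exact Matrix.exists_mulVec_eq_zero_iff.1 ⟨x, hx0, hker⟩

/-- **Minkowski's determinant inequality**: for real positive semidefinite `A, B` of size
`N ≥ 1`, `(det A)^{1/N} + (det B)^{1/N} ≤ (det (A + B))^{1/N}`. Variational proof from the
determinant–trace AM–GM: with `S = A + B` invertible and `C = (det S)^{1/N} S⁻¹ ⪰ 0`
(`det C = 1`, `Tr(S C) = N (det S)^{1/N}`), `N (det A)^{1/N} + N (det B)^{1/N} ≤ Tr(A C) + Tr(B C)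
= Tr(S C)`; a singular `S` forces `det A = det B = 0`. [cite: Serre2024, Lemma 7 (concavity of det^{1/n})] -/
theorem det_rpow_add_det_rpow_le [Nonempty n] {A B : Matrix n n ℝ} (hA : A.PosSemidef)
    (hB : B.PosSemidef) :
    A.det ^ (1 / (Fintype.card n : ℝ)) + B.det ^ (1 / (Fintype.card n : ℝ)) ≤
      (A + B).det ^ (1 / (Fintype.card n : ℝ)) := by
  set N : ℕ := Fintype.card n with hN
  have hNpos : (0 : ℝ) < N := Nat.cast_pos.2 Fintype.card_pos
  have he0 : (1 / (N : ℝ)) ≠ 0 := one_div_ne_zero hNpos.ne'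
  have hS : (A + B).PosSemidef := hA.add hB
  by_cases hdet : (A + B).det = 0
  · -- singular sum: everything vanishes
    have hA0 : A.det = 0 := det_eq_zero_of_posSemidef_add_det_eq_zero hA hB hdet
    have hB0 : B.det = 0 :=
      det_eq_zero_of_posSemidef_add_det_eq_zero hB hA (by rwa [add_comm])
    rw [hA0, hB0, hdet, Real.zero_rpow he0, add_zero]
  -- invertible sum: the optimal `C`
  set S := A + B with hSdef
  have hSpos : 0 < S.det := lt_of_le_of_ne hS.det_nonneg (Ne.symm hdet)
  have hunit : IsUnit S.det := isUnit_iff_ne_zero.2 hdet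
  set μ : ℝ := S.det ^ (1 / (N : ℝ)) with hμ
  have hμpos : 0 < μ := Real.rpow_pos_of_pos hSpos _
  set C : Matrix n n ℝ := μ • S⁻¹ with hC
  have hCpsd : C.PosSemidef := hS.inv.smul hμpos.le
  have hμN : μ ^ N = S.det := by
    rw [hμ, ← Real.rpow_natCast, ← Real.rpow_mul hSpos.le, one_div_mul_cancel hNpos.ne',
      Real.rpow_one]
  have hCdet : C.det = 1 := by
    rw [hC, det_smul, ← hN, hμN, det_nonsing_inv, Ring.inverse_eq_inv, mul_inv_cancel₀ hdet]
  have hCtr : (S * C).trace = N * μ := by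
    rw [hC, Matrix.mul_smul, mul_nonsing_inv S hunit, trace_smul, trace_one, smul_eq_mul, ← hN,
      mul_comm]
  have hAC := card_mul_det_mul_det_rpow_le_trace_mul hA hCpsd
  have hBC := card_mul_det_mul_det_rpow_le_trace_mul hB hCpsd
  rw [hCdet, mul_one, ← hN] at hAC hBC
  have hsum : (N : ℝ) * (A.det ^ (1 / (N : ℝ)) + B.det ^ (1 / (N : ℝ))) ≤ N * μ := by
    calc (N : ℝ) * (A.det ^ (1 / (N : ℝ)) + B.det ^ (1 / (N : ℝ)))
        = N * A.det ^ (1 / (N : ℝ)) + N * B.det ^ (1 / (N : ℝ)) := by ring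
      _ ≤ (A * C).trace + (B * C).trace := add_le_add hAC hBC
      _ = (S * C).trace := by rw [hSdef, Matrix.add_mul, trace_add]
      _ = N * μ := hCtr
  exact le_of_mul_le_mul_left hsum hNpos

/-- **Monotonicity of the determinant on the positive semidefinite cone**:
`det A ≤ det (A + B)` for `A, B ⪰ 0`. [folklore] -/
theorem det_le_det_add_of_posSemidef {A B : Matrix n n ℝ} (hA : A.PosSemidef)
    (hB : B.PosSemidef) : A.det ≤ (A + B).det := by
  rcases isEmpty_or_nonempty n with hn | hn
  · simp [Matrix.det_isEmpty]
  have hNpos : (0 : ℝ) < Fintype.card n := Nat.cast_pos.2 Fintype.card_pos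
  have h := det_rpow_add_det_rpow_le hA hB
  have hB0 : 0 ≤ B.det ^ (1 / (Fintype.card n : ℝ)) := Real.rpow_nonneg hB.det_nonneg _
  have h' : A.det ^ (1 / (Fintype.card n : ℝ)) ≤ (A + B).det ^ (1 / (Fintype.card n : ℝ)) := by
    linarith
  exact (Real.rpow_le_rpow_iff hA.det_nonneg (hA.add hB).det_nonneg (by positivity)).1 h'

/-- Homogeneity: `(det (t • A))^{1/N} = t (det A)^{1/N}` for `t ≥ 0`, `det A ≥ 0`, `N ≥ 1`.
[folklore] -/
theorem det_smul_rpow [Nonempty n] {A : Matrix n n ℝ} (hA : 0 ≤ A.det) {t : ℝ} (ht : 0 ≤ t) :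
    (t • A).det ^ (1 / (Fintype.card n : ℝ)) = t * A.det ^ (1 / (Fintype.card n : ℝ)) := by
  have hNpos : (0 : ℝ) < Fintype.card n := Nat.cast_pos.2 Fintype.card_pos
  rw [det_smul, Real.mul_rpow (pow_nonneg ht _) hA, ← Real.rpow_natCast,
    ← Real.rpow_mul ht, mul_one_div_cancel hNpos.ne', Real.rpow_one]

omit [Fintype n] [DecidableEq n] in
/-- The positive semidefinite cone of real matrices is convex. [folklore] -/
theorem convex_setOf_posSemidef : Convex ℝ {A : Matrix n n ℝ | A.PosSemidef} := by
  intro A hA B hB a b ha hb _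
  exact (hA.smul ha).add (hB.smul hb)

/-- **Concavity of `det^{1/N}` on the positive semidefinite cone** (Serre 2024, Lemma 7,
citing Serre, *Matrices*, Thm. 6.10): `A ↦ (det A)^{1/N}` is concave on `{A | A ⪰ 0}` (`N ≥ 1`),
from Minkowski's inequality and homogeneity. [cite: Serre2024, Lemma 7] -/
theorem concaveOn_det_rpow [Nonempty n] :
    ConcaveOn ℝ {A : Matrix n n ℝ | A.PosSemidef} fun A => A.det ^ (1 / (Fintype.card n : ℝ)) := by
  refine ⟨convex_setOf_posSemidef, fun A hA B hB a b ha hb _ => ?_⟩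
  have hA' : (a • A).PosSemidef := hA.smul ha
  have hB' : (b • B).PosSemidef := hB.smul hb
  have h := det_rpow_add_det_rpow_le hA' hB'
  rw [det_smul_rpow hA.det_nonneg ha, det_smul_rpow hB.det_nonneg hb] at h
  simpa [smul_eq_mul] using h

end Literature.LinearAlgebra.Matrix
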